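import Literature.NumberTheory.Automorphic.LocalUnitaryGroupNoncompactRankTwo
import Literature.NumberTheory.Automorphic.LocalUnitaryGroupSimilitudeLevelRankTwo
import Literature.NumberTheory.Automorphic.Liu2021.LemD1AsPrintedIndexedNonVacuityNonsplitPlace
import Literature.AlgebraicGeometry.ShimuraVarieties.UnitaryAnisotropicLineFrame
import Literature.NumberTheory.Automorphic.UnitaryGroupFormCongrFinSum
import HarnessLib

/-!
# Two ANISOTROPIC hermitian planes at a finite place are congruent: `U(H)(L⁺_v) ≃ₜ* U(H′)(L⁺_v)` for `v ∈ T(H) ∩ T(H′)`,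
# and the rank-2 dichotomy «isomorphic local unitary groups iff co-isotropic»

Topic `NumberTheory/Automorphic`; namespace `Literature.NumberTheory.Automorphic.UnitaryGroup`.  KERNEL ONLY: theorems, no
definition, no named fact, no instance, no notation, no `sorry`.  The ANISOTROPIC companion of ★ `LocalHermitianPlaneIsotropic`
(isotropic plane ⇒ `≅ Φ₂`) and ★ `LocalUnitaryGroupNoncompactRankTwo` (anisotropic plane ⇒ NOT `≅ Φ₂`): together the three files are
the rank-2 case of the local classification of hermitian forms [Jacobowitz1962, Thm. 3.1] (rank and discriminant class in
`F_vˣ/N(E_vˣ)`; [Rogawski1990, §3.8 p. 33]: the unitary groups in two variables at `v` ↔ `F_v^*/NE_v^*`) in the tree's carriers.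

**Setting.** `E/F` quadratic with automorphism `c` (`c δ = -δ ≠ 0`), `v` a finite place of `F` NOT split in `E` (`w ∣ v`, `c • w = w`; then
`E_v = UnitaryGroup.LocalRing E v` is a field), `σ = c ⊗ 1 = conjLocal E c v`, `H, H′ ∈ M₂(E)` `c`-hermitian, `det ≠ 0`, `H_v = H.map (E → E_v)`.

**Results.** §1 pure algebra (`anisotropic_formCongr`, the shape `diag(b, a) = !![b, 0; 0, a]`: its pairing,
its rescaling by `diag(z, 1)`, `exists_formCongr_eq_diagTwo_of_hermForm_self_ne_zero` from ★ `exists_frame_formCongr_eq_finSum_of_isHermitian`,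
the test vector `(1, z)`).  §2 **`exists_formCongr_map_eq_map_of_anisotropic`**: at a non-split `v`, `H_v`, `H′_v` both ANISOTROPIC
(`h_v(r,r) = 0 → r = 0`) ⟹ `ᵗσ(T) · H_v · T = H′_v` for some `T ∈ GL₂(E_v)`.  Proof: `H ⊕ᶠ (−H′)` has rank `4`, so it is isotropic at `v`
(★ `exists_isotropic_localGram`, `u(F_v) = 4`): a COMMON VALUE `h_v(x,x) = h′_v(y,y) = a ≠ 0`, whence `H_v ≅ diag(b, a)`, `H′_v ≅ diag(b′, a)`;
anisotropy makes `−b/a`, `−b′/a` non-norms, the norm subgroup has index EXACTLY `2` in `F_vˣ` (★ `index_norms_eq_two_of_nonsplit` ←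
★ `QuadraticForms.index_quadraticNormSubgroup_adicCompletion_eq_two`, O'Meara 63:13a), so `b′/b = z·σz` and `diag(b,a) ≅ diag(b′,a)` by
`diag(z,1)` — the even-rank half of [Jacobowitz1962, Thm. 3.1] (the discriminant class of an anisotropic plane is forced).  §3 CM packaging (`F = L⁺`, `E = L`, carriers `(cmDatum L 2 H).Local v`): **`nonempty_cmDatum_local_equiv_of_anisotropic`**,
the conjugation form **`exists_cmDatum_localEquiv_corresponds_two_of_anisotropic`** (`e g = T⁻¹ g T`, `γ ↔ e γ`, ★ `Rogawski1990.Corresponds`: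
the shape in which a local letter at `v ∈ T` typed on ONE anisotropic plane moves to every other), the standing-data currency
`nonempty_cmDatum_local_equiv_of_not_isIsotropic`, and the DICHOTOMY **`nonempty_cmDatum_local_equiv_two_iff`**:
`Nonempty (U(H)_v ≃ₜ* U(H′)_v) ↔ (H_v isotropic ↔ H′_v isotropic)` at every finite `v`.

Written for the cell `hodgecm-mathlib` (ENGINE T1, the `N = 2` edition of line `F0_T1InnerFormTraceIdentity`, SPEC-ed1.19c §7 T1g(2,H) (ii)
«at `v ∈ S ⊇ T` a local inner-transfer datum»: the carrier on which a local letter at an anisotropic place is stated once).  HC_CM is proved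
only modulo the printed citations until rung 0 closes; this file is unconditional and asserts nothing about transfer.

## References
* [Jacobowitz1962] R. Jacobowitz, *Hermitian forms over local fields*, Amer. J. Math. 84 (1962) 441–465, §3 Thm. 3.1.
* [Rogawski1990] J. Rogawski, *Automorphic representations of unitary groups in three variables* (1990), §3.8 p. 33, §14.2 p. 232.
* [Omeara1963] O. T. O'Meara, *Introduction to Quadratic Forms* (1963), §63B Cor. 63:13a.
* [Scharlau1985HermitianForms] W. Scharlau, *Quadratic and Hermitian Forms*, Grundlehren 270 (1985), Ch. 10 §1.
* [PlatonovRapinchuk1994] V. Platonov, A. Rapinchuk, *Algebraic Groups and Number Theory* (1994), §2.3.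
-/

set_option autoImplicit false

noncomputable section

open Matrix NumberField IsDedekindDomain
open Literature.NumberTheory.Rogawski1990 (Corresponds corresponds_comm)

namespace Literature.NumberTheory.Automorphic.UnitaryGroup

/-! ## §1 Pure algebra: congruence transport of the pairing, the shape `diag(b, a)`, direct sums -/

section Algebra

variable {K : Type*} [CommRing K] (σ : K →+* K)

/-- **anisotropy is a congruence invariant**: if `h_H(u,u) = 0 → u = 0` then the same holds for `ᵗσ(T)·H·T`, `T ∈ GLₙ(K)`.
[cite: Dieudonne1971GroupesClassiques, Chap. II §5] -/
theorem anisotropic_formCongr {n : Type*} [Fintype n] [DecidableEq n] (T : GL n K) {H : Matrix n n K}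
    (hanis : ∀ u : n → K, hermForm σ H u u = 0 → u = 0) (u : n → K) (hu : hermForm σ (formCongr σ T H) u u = 0) : u = 0 := by
  rw [← hermForm_mulVec_mulVec_eq_hermForm_formCongr] at hu
  have : ((T⁻¹ : GL n K) : Matrix n n K) *ᵥ ((T : Matrix n n K) *ᵥ u) = u := by
    rw [Matrix.mulVec_mulVec, ← Units.val_mul, inv_mul_cancel, Units.val_one, Matrix.one_mulVec]
  rw [← this, hanis _ hu, Matrix.mulVec_zero]

/-- **the pairing of the diagonal plane `diag(b, a) = !![b, 0; 0, a]`**: `h(u, u') = σu₀·b·u'₀ + σu₁·a·u'₁`. [folklore] -/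
private theorem hermForm_diagTwo (b a : K) (u u' : Fin 2 → K) :
    hermForm σ !![b, 0; 0, a] u u' = σ (u 0) * b * u' 0 + σ (u 1) * a * u' 1 := by
  simp only [hermForm_apply, dotProduct, Matrix.mulVec, Fin.sum_univ_two, Function.comp_apply, Matrix.of_apply,
    Matrix.cons_val', Matrix.cons_val_zero, Matrix.cons_val_one, Matrix.empty_val', Matrix.cons_val_fin_one]
  ring

/-- `det !![z, 0; 0, 1] = z`. [folklore] -/
private theorem det_scaleTwo (z : K) : Matrix.det !![z, 0; 0, (1 : K)] = z := by rw [Matrix.det_fin_two_of]; ring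

/-- **rescaling the first basis vector**: `ᵗσ(D)·diag(b, a)·D = diag(σz·b·z, a)` for `D = diag(z, 1)`, `z ≠ 0`. [folklore] -/
private theorem formCongr_scaleTwo_diagTwo {K : Type*} [Field K] (σ : K →+* K) (b a z : K) (hz : z ≠ 0) :
    formCongr σ (Matrix.GeneralLinearGroup.mkOfDetNeZero !![z, 0; 0, (1 : K)] (by rw [det_scaleTwo]; exact hz)) !![b, 0; 0, a] =
      !![σ z * b * z, 0; 0, a] := by
  ext i j
  fin_cases i <;> fin_cases j <;>
    simp [formCongr, Matrix.GeneralLinearGroup.mkOfDetNeZero, Matrix.mul_apply, Fin.sum_univ_two, Matrix.map_apply]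

/-- `J⋆ ⊕ᶠ (a) = !![J⋆₀₀, 0; 0, a]` for a `1 × 1` block `J⋆` (★ `UnitaryGroup.finSum` at `N₁ = N₂ = 1`). [folklore] -/
private theorem finSum_one_one_eq (J : Matrix (Fin 1) (Fin 1) K) (a : K) : finSum 1 1 J !![a] = !![J 0 0, 0; 0, a] := by
  ext i j
  fin_cases i <;> fin_cases j
  · exact Literature.AlgebraicGeometry.ShimuraVarieties.finSum_one_apply_castSucc_castSucc J !![a] 0 0
  · exact Literature.AlgebraicGeometry.ShimuraVarieties.finSum_one_apply_castSucc_last J !![a] 0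
  · exact Literature.AlgebraicGeometry.ShimuraVarieties.finSum_one_apply_last_castSucc J !![a] 0
  · exact (Literature.AlgebraicGeometry.ShimuraVarieties.finSum_one_apply_last_last J !![a]).trans (by simp)

/-- **a non-isotropic vector puts a hermitian plane in the shape `diag(b, a)`**: `σ` an involution of the field `K`, `H ∈ M₂(K)`
`σ`-hermitian, `h(x, x) = a ≠ 0` ⟹ `ᵗσ(B)·H·B = !![b, 0; 0, a]` for some `B ∈ GL₂(K)`, `b ∈ K` (frame `(x⋆, x)`, `x⋆` spanning `x^⊥`;
★ `exists_frame_formCongr_eq_finSum_of_isHermitian` at `n = 1`). [cite: Scharlau1985HermitianForms, Ch. 10 §1] -/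
theorem exists_formCongr_eq_diagTwo_of_hermForm_self_ne_zero {K : Type*} [Field K] (σ : K →+* K) (hσ : ∀ s, σ (σ s) = s)
    {H : Matrix (Fin 2) (Fin 2) K} (hH : (H.map σ)ᵀ = H) {x : Fin 2 → K} {a : K} (hx : hermForm σ H x x = a) (ha : a ≠ 0) :
    ∃ (B : GL (Fin 2) K) (b : K), σ b = b ∧ formCongr σ B H = !![b, 0; 0, a] := by
  have hx' : Literature.AlgebraicGeometry.ShimuraVarieties.hermForm σ H x x ≠ 0 := ne_of_eq_of_ne (hx :) ha
  obtain ⟨Jstar, B, hB, -, -, -⟩ :=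
    Literature.AlgebraicGeometry.ShimuraVarieties.exists_frame_formCongr_eq_finSum_of_isHermitian (n := 1) σ H hσ hH x hx'
  have hB' : formCongr σ B H = !![Jstar 0 0, 0; 0, a] := by
    rw [hB, finSum_one_one_eq]
    change !![Jstar 0 0, 0; 0, hermForm σ H x x] = _
    rw [hx]
  refine ⟨B, Jstar 0 0, ?_, hB'⟩
  have h := congrFun (congrFun (transpose_map_formCongr σ hσ B H) 0) 0
  rw [hH, hB', Matrix.transpose_apply, Matrix.map_apply] at h
  simpa using h

/-- `ᵗ((J₁ ⊕ᶠ J₂).map f) = (ᵗ(J₁.map f)) ⊕ᶠ (ᵗ(J₂.map f))` (so `J₁ ⊕ᶠ J₂` is `σ`-hermitian when `J₁, J₂` are): the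
orthogonal direct sum of hermitian spaces. [cite: Kudla1984, §1] -/
theorem transpose_finSum_map {K' : Type*} [CommRing K'] {N₁ N₂ : ℕ} (f : K →+* K') (J₁ : Matrix (Fin N₁) (Fin N₁) K)
    (J₂ : Matrix (Fin N₂) (Fin N₂) K) :
    ((finSum N₁ N₂ J₁ J₂).map f)ᵀ = finSum N₁ N₂ ((J₁.map f)ᵀ) ((J₂.map f)ᵀ) := by
  rw [finSum_map, finSum, finSum, Matrix.transpose_reindex, Matrix.fromBlocks_transpose, Matrix.transpose_zero,
    Matrix.transpose_zero]

end Algebra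

/-! ## §2 At a non-split place two anisotropic hermitian planes are congruent -/

section Local

variable {F : Type} [Field F] [NumberField F] (E : Type) [Field E] [NumberField E] [Algebra F E]
  [Algebra.IsQuadraticExtension F E] (c : E ≃ₐ[F] E)

/-- `δ · δ ∈ F` for `c δ = -δ` (`E = F ⊕ F δ`, and `c` fixes `δ²`). [folklore] -/
private theorem exists_delta_mul_self_eq_algebraMap {δ : E} (hcδ : c δ = -δ) (hδ : δ ≠ 0) : ∃ d : F, δ * δ = algebraMap F E d := by
  obtain ⟨x, y, hxy⟩ := exists_eq_add_mul_of_isQuadraticExtension (F := F) (E := E)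
    (not_mem_range_algebraMap_of_apply_eq_neg E c hcδ hδ) (δ * δ)
  have hc2 : c (δ * δ) = δ * δ := by rw [map_mul, hcδ, neg_mul_neg]
  have hy : algebraMap F E y * δ = 0 := by
    have h1 : c (δ * δ) = algebraMap F E x - algebraMap F E y * δ := by
      rw [hxy, map_add, map_mul, AlgEquiv.commutes, AlgEquiv.commutes, hcδ, mul_neg, sub_eq_add_neg]
    rw [hc2, hxy] at h1
    have h2 : (2 : E) * (algebraMap F E y * δ) = 0 := by linear_combination h1
    exact (mul_eq_zero.1 h2).resolve_left two_ne_zero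
  exact ⟨x, by rw [hxy, hy, add_zero]⟩

/-- **the test vector `(1, z)`**: `diag(b, a)` anisotropic ⇒ `b + a · (z · σz) ≠ 0` for every `z` — the discriminant condition
«`−b/a ∉ N(E_vˣ)`» of an anisotropic plane. [cite: Jacobowitz1962, §3 Thm. 3.1] [cite: Omeara1963, §63B] -/
theorem add_mul_norm_ne_zero_of_anisotropic_diagTwo {K : Type*} [CommRing K] [Nontrivial K] (σ : K →+* K) (hσ1 : σ 1 = 1) {b a : K}
    (hanis : ∀ u : Fin 2 → K, hermForm σ !![b, 0; 0, a] u u = 0 → u = 0) (z : K) : b + a * (z * σ z) ≠ 0 := by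
  intro h0
  have hu : hermForm σ !![b, 0; 0, a] ![1, z] ![1, z] = 0 := by
    rw [hermForm_diagTwo]
    simp only [Matrix.cons_val_zero, Matrix.cons_val_one, hσ1, one_mul, mul_one]
    linear_combination h0
  have h10 : (![(1 : K), z]) 0 = 0 := by rw [hanis _ hu]; rfl
  exact one_ne_zero ((Matrix.cons_val_zero (1 : K) ![z]).symm.trans h10)

/-- `diag(b, a)` anisotropic ⇒ `b ≠ 0` (the test vector `(1, 0)`). [cite: Jacobowitz1962, §3 Thm. 3.1] -/
theorem ne_zero_of_anisotropic_diagTwo {K : Type*} [CommRing K] [Nontrivial K] (σ : K →+* K) {b a : K}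
    (hanis : ∀ u : Fin 2 → K, hermForm σ !![b, 0; 0, a] u u = 0 → u = 0) : b ≠ 0 := by
  have h := add_mul_norm_ne_zero_of_anisotropic_diagTwo σ (map_one σ) hanis 0
  rwa [map_zero, mul_zero, mul_zero, add_zero] at h

variable {E c}

/-- **Two ANISOTROPIC hermitian planes are congruent at a non-split place** ([Jacobowitz1962, Thm. 3.1] at rank `2`, even-rank half:
rank and discriminant classify, and the discriminant class of an anisotropic plane is forced).  `c δ = -δ ≠ 0`, `H, H′ ∈ M₂(E)`
`c`-hermitian with `det ≠ 0`, `w ∣ v` with `c • w = w`, both local Gram matrices ANISOTROPIC over `E_v` (`h_v(r,r) = 0 → r = 0`)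
⟹ `ᵗ(c ⊗ 1)(T) · H_v · T = H′_v` for some `T ∈ GL₂(E_v)` (proof: module docstring — common value via ★ `exists_isotropic_localGram` on
`(H ⊕ᶠ (−H′))_v`, norm index `2`). [cite: Jacobowitz1962, §3 Thm. 3.1] [cite: Rogawski1990, §3.8 p. 33] [cite: Omeara1963, §63B Cor. 63:13a] -/
theorem exists_formCongr_map_eq_map_of_anisotropic {δ : E} (hcδ : c δ = -δ) (hδ : δ ≠ 0) (H H' : Matrix (Fin 2) (Fin 2) E)
    (hHh : (H.map c)ᵀ = H) (hHd : H.det ≠ 0) (hH'h : (H'.map c)ᵀ = H') (hH'd : H'.det ≠ 0) {v : HeightOneSpectrum (𝓞 F)}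
    (w : PlacesOver E v) (hw : c • w.1 = w.1)
    (hanis : ∀ r : Fin 2 → LocalRing E v,
      hermForm (conjLocal E c v) ((adelicForm E 2 H).map (adeleToLocal E v)) r r = 0 → r = 0)
    (hanis' : ∀ r : Fin 2 → LocalRing E v,
      hermForm (conjLocal E c v) ((adelicForm E 2 H').map (adeleToLocal E v)) r r = 0 → r = 0) :
    ∃ T : GL (Fin 2) (LocalRing E v),
      formCongr (conjLocal E c v) T (H.map (algebraMap E (LocalRing E v))) = H'.map (algebraMap E (LocalRing E v)) := by
  have hE : IsField (LocalRing E v) := Liu2021.LemD1IndexedNonVacuityNonsplitPlace.isField_localRing_of_nonsplit E v c hcδ hδ w hw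
  letI : Field (LocalRing E v) := hE.toField
  set σ := conjLocal E c v with hσdef
  set ι := algebraMap E (LocalRing E v) with hιdef
  have hσσ : ∀ s, σ (σ s) = s := Liu2021.LemD1OfPlace.conjLocal_conjLocal_apply E v c hcδ hδ
  rw [adelicForm_map_adeleToLocal] at hanis hanis'
  have hHv : ((H.map ι).map σ)ᵀ = H.map ι := by
    rw [hιdef, ← adelicForm_map_adeleToLocal]; exact Liu2021.LemD1OfPlace.localGram_hermitian E v c 2 H hHh
  have hH'v : ((H'.map ι).map σ)ᵀ = H'.map ι := by
    rw [hιdef, ← adelicForm_map_adeleToLocal]; exact Liu2021.LemD1OfPlace.localGram_hermitian E v c 2 H' hH'h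
  -- Step 1: the rank-4 form `J = H ⊕ᶠ (−H')` is isotropic at `v`
  set J : Matrix (Fin (2 + 2)) (Fin (2 + 2)) E := finSum 2 2 H (-H') with hJdef
  have hJh : (J.map c)ᵀ = J := by
    change ((finSum 2 2 H (-H')).map (c : E →+* E))ᵀ = finSum 2 2 H (-H')
    rw [transpose_finSum_map]
    change finSum 2 2 ((H.map c)ᵀ) (((-H').map c)ᵀ) = finSum 2 2 H (-H')
    rw [hHh, Matrix.map_neg _ (map_neg c), Matrix.transpose_neg, hH'h]
  have hJdet : J.det ≠ 0 := by
    rw [hJdef, det_finSum, Matrix.det_neg, Fintype.card_fin]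
    exact mul_ne_zero hHd (mul_ne_zero (by norm_num) hH'd)
  obtain ⟨r, hr0, hr⟩ := exists_isotropic_localGram E c (2 + 2) J v hcδ hδ (by norm_num) hJh hJdet
  set x : Fin 2 → LocalRing E v := fun i => r (Fin.castAdd 2 i) with hxdef
  set y : Fin 2 → LocalRing E v := fun j => r (Fin.natAdd 2 j) with hydef
  have hrxy : Fin.append x y = r := Fin.append_castAdd_natAdd
  rw [adelicForm_map_adeleToLocal, hJdef, finSum_map, Matrix.map_neg _ (map_neg ι), ← hrxy, hermForm_finSum_append] at hr
  have hneg : hermForm σ (-(H'.map ι)) y y = -hermForm σ (H'.map ι) y y := by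
    rw [hermForm_apply, hermForm_apply, Matrix.neg_mulVec, dotProduct_neg]
  rw [hneg, ← sub_eq_add_neg, sub_eq_zero] at hr
  set a := hermForm σ (H.map ι) x x with hadef
  have ha0 : a ≠ 0 := by
    intro ha
    have hx0 : x = 0 := hanis x ha
    have hy0 : y = 0 := hanis' y (by rw [← hr, ha])
    apply hr0
    rw [← hrxy, hx0, hy0]
    funext k
    induction k using Fin.addCases with
    | left i => rw [Fin.append_left]; rfl
    | right j => rw [Fin.append_right]; rfl
  -- Step 2: the shapes `diag(b, a)` and `diag(b', a)`
  obtain ⟨B, b, hfix_b, hB⟩ := exists_formCongr_eq_diagTwo_of_hermForm_self_ne_zero σ hσσ hHv hadef.symm ha0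
  obtain ⟨B', b', hfix_b', hB'⟩ := exists_formCongr_eq_diagTwo_of_hermForm_self_ne_zero σ hσσ hH'v hr.symm ha0
  have hanisB : ∀ u : Fin 2 → LocalRing E v, hermForm σ !![b, 0; 0, a] u u = 0 → u = 0 := by
    rw [← hB]; exact anisotropic_formCongr σ B hanis
  have hanisB' : ∀ u : Fin 2 → LocalRing E v, hermForm σ !![b', 0; 0, a] u u = 0 → u = 0 := by
    rw [← hB']; exact anisotropic_formCongr σ B' hanis'
  have hσ1 : σ 1 = 1 := map_one σ
  have hb0 : b ≠ 0 := ne_zero_of_anisotropic_diagTwo σ hanisB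
  have hb'0 : b' ≠ 0 := ne_zero_of_anisotropic_diagTwo σ hanisB'
  have hfix_a : σ a = a := by rw [hadef]; exact conj_hermForm σ _ hσσ hHv x x
  obtain ⟨pa, hpa⟩ := Liu2021.LemD1OfPlace.exists_toLocalRing_eq_of_conjLocal_eq E v c hcδ hδ a hfix_a
  obtain ⟨pb, hpb⟩ := Liu2021.LemD1OfPlace.exists_toLocalRing_eq_of_conjLocal_eq E v c hcδ hδ b hfix_b
  obtain ⟨pb', hpb'⟩ := Liu2021.LemD1OfPlace.exists_toLocalRing_eq_of_conjLocal_eq E v c hcδ hδ b' hfix_b'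
  have hpa0 : pa ≠ 0 := by rintro rfl; exact ha0 (by rw [← hpa, map_zero])
  have hpb0 : pb ≠ 0 := by rintro rfl; exact hb0 (by rw [← hpb, map_zero])
  have hpb'0 : pb' ≠ 0 := by rintro rfl; exact hb'0 (by rw [← hpb', map_zero])
  -- Step 3: `−b/a`, `−b'/a` are NOT norms; the norm subgroup has index `2`; hence `b'/b` IS a norm
  obtain ⟨d, hd⟩ := exists_delta_mul_self_eq_algebraMap E c hcδ hδ
  have hnot : ∀ {q : v.adicCompletion F} (hq : q ≠ 0) {bb : LocalRing E v}, toLocalRing E v q * a = -bb →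
      (∀ u : Fin 2 → LocalRing E v, hermForm σ !![bb, 0; 0, a] u u = 0 → u = 0) →
      Units.mk0 q hq ∉ QuadraticForms.quadraticNormSubgroup (v.adicCompletion F) (d : v.adicCompletion F) := by
    intro q hq bb hqe hanisq hmem
    obtain ⟨z, hz⟩ := (Liu2021.LemD1IndexedNonVacuityNonsplitPlace.isNorm_iff_mem_quadraticNormSubgroup E v c hcδ hδ hd
      (Units.mk0 q hq)).2 hmem
    rw [Units.val_mk0, algebraMap_localRing_eq] at hz
    refine add_mul_norm_ne_zero_of_anisotropic_diagTwo σ hσ1 hanisq (z : LocalRing E v) ?_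
    rw [hz, mul_comm a, hqe, add_neg_cancel]
  have hq0 : -(pb * pa⁻¹) ≠ 0 := neg_ne_zero.2 (mul_ne_zero hpb0 (inv_ne_zero hpa0))
  have hq'0 : -(pb' * pa⁻¹) ≠ 0 := neg_ne_zero.2 (mul_ne_zero hpb'0 (inv_ne_zero hpa0))
  have hqa : toLocalRing E v (-(pb * pa⁻¹)) * a = -b := by rw [← hpa, ← map_mul, neg_mul, inv_mul_cancel_right₀ hpa0, map_neg, hpb]
  have hqa' : toLocalRing E v (-(pb' * pa⁻¹)) * a = -b' := by rw [← hpa, ← map_mul, neg_mul, inv_mul_cancel_right₀ hpa0, map_neg, hpb']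
  have hn := hnot hq0 hqa hanisB
  have hn' := hnot hq'0 hqa' hanisB'
  have hidx := Liu2021.LemD1IndexedNonVacuityNonsplitPlace.index_norms_eq_two_of_nonsplit E v c hcδ hδ w hw hd
  have hmem : Units.mk0 (pb' * pb⁻¹) (mul_ne_zero hpb'0 (inv_ne_zero hpb0)) ∈
      QuadraticForms.quadraticNormSubgroup (v.adicCompletion F) (d : v.adicCompletion F) := by
    have hprod : Units.mk0 (pb' * pb⁻¹) (mul_ne_zero hpb'0 (inv_ne_zero hpb0)) = Units.mk0 _ hq'0 * (Units.mk0 _ hq0)⁻¹ := by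
      ext
      simp only [Units.val_mk0, Units.val_mul, Units.val_inv_eq_inv_val]
      field_simp
    rw [hprod, Subgroup.mul_mem_iff_of_index_two hidx, Subgroup.inv_mem_iff]
    exact iff_of_false hn' hn
  obtain ⟨z, hz⟩ := (Liu2021.LemD1IndexedNonVacuityNonsplitPlace.isNorm_iff_mem_quadraticNormSubgroup E v c hcδ hδ hd _).2 hmem
  rw [Units.val_mk0, algebraMap_localRing_eq] at hz
  have hz0 : (z : LocalRing E v) ≠ 0 := z.ne_zero
  have hscale : σ z * b * z = b' := by
    rw [(by ring : σ (z : LocalRing E v) * b * z = (z : LocalRing E v) * σ z * b), hz, ← hpb, ← map_mul,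
      inv_mul_cancel_right₀ hpb0, hpb']
  -- Step 4: assemble `T = B · D · B'⁻¹`
  set D : GL (Fin 2) (LocalRing E v) :=
    Matrix.GeneralLinearGroup.mkOfDetNeZero !![(z : LocalRing E v), 0; 0, 1] (by rw [det_scaleTwo]; exact hz0) with hDdef
  refine ⟨B * D * B'⁻¹, ?_⟩
  rw [formCongr_mul_eq, formCongr_mul_eq, hB, hDdef, formCongr_scaleTwo_diagTwo σ b a z hz0, hscale, ← hB', formCongr_inv_formCongr]

end Local

/-! ## §3 The CM packaging: `U(H)(L⁺_v) ≃ₜ* U(H′)(L⁺_v)` for `v ∈ T(H) ∩ T(H′)`, and the dichotomy -/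

section CM

variable (L : Type) [Field L] [NumberField L] [IsCMField L]

/-- a non-zero purely imaginary `δ = x - x̄` of the CM field `L`. [folklore] -/
private theorem exists_complexConj_eq_neg_ne_zero : ∃ δ : L, IsCMField.complexConj L δ = -δ ∧ δ ≠ 0 := by
  obtain ⟨x, hx⟩ := Literature.NumberTheory.NumberFields.IsCMField.exists_complexConj_ne L
  exact ⟨x - IsCMField.complexConj L x, by rw [map_sub, IsCMField.complexConj_apply_apply, neg_sub],
    sub_ne_zero.2 (Ne.symm hx)⟩

/-- **`U(H)(L⁺_v) ≃ₜ* U(H′)(L⁺_v)` at a finite place where BOTH hermitian planes are anisotropic**: `H, H′ ∈ M₂(L)` hermitian with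
`det ≠ 0`, `v` a finite place of `L⁺` with both local Gram matrices anisotropic above every NON-SPLIT `w ∣ v` (split `v`: both groups are
`GL₂(L_w)`, ★ `cmDatumLocalSplitCongr`) ⟹ the local unitary groups are isomorphic, by conjugation with the `T` of §2 (★ `cmDatumLocalCongr`).
[cite: Jacobowitz1962, §3 Thm. 3.1] [cite: Rogawski1990, §3.8 p. 33] [cite: PlatonovRapinchuk1994, §2.3] -/
theorem nonempty_cmDatum_local_equiv_of_anisotropic (H H' : Matrix (Fin 2) (Fin 2) L)
    (hH : (H.map (cmConjRingHom L))ᵀ = H) (hHd : H.det ≠ 0) (hH' : (H'.map (cmConjRingHom L))ᵀ = H') (hH'd : H'.det ≠ 0)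
    (v : HeightOneSpectrum (𝓞 ↥(maximalRealSubfield L)))
    (hanis : ∀ w : PlacesOver L v, IsCMField.complexConj L • w.1 = w.1 → ∀ r : Fin 2 → LocalRing L v,
      hermForm (conjLocal L (IsCMField.complexConj L) v) ((adelicForm L 2 H).map (adeleToLocal L v)) r r = 0 → r = 0)
    (hanis' : ∀ w : PlacesOver L v, IsCMField.complexConj L • w.1 = w.1 → ∀ r : Fin 2 → LocalRing L v,
      hermForm (conjLocal L (IsCMField.complexConj L) v) ((adelicForm L 2 H').map (adeleToLocal L v)) r r = 0 → r = 0) :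
    Nonempty ((cmDatum L 2 H).Local v ≃ₜ* (cmDatum L 2 H').Local v) := by
  obtain ⟨w⟩ : Nonempty (PlacesOver L v) := inferInstance
  by_cases hw : IsCMField.complexConj L • w.1 = w.1
  · obtain ⟨δ, hcδ, hδ⟩ := exists_complexConj_eq_neg_ne_zero L
    obtain ⟨T, hT⟩ := exists_formCongr_map_eq_map_of_anisotropic hcδ hδ H H'
      ((map_cmConjRingHom_eq_map_complexConj L H) ▸ hH) hHd ((map_cmConjRingHom_eq_map_complexConj L H') ▸ hH') hH'd w hw
      (hanis w hw) (hanis' w hw)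
    exact ⟨(cmDatumLocalCongr L v T isUnit_one (by rw [hT, one_smul])).symm⟩
  · exact ⟨cmDatumLocalSplitCongr L hH (isUnit_iff_ne_zero.2 hHd) hH' (isUnit_iff_ne_zero.2 hH'd) w hw⟩

/-- **The identification as a CONJUGATION with class correspondence** (the shape of a local datum at `v ∈ T`): at a NON-SPLIT `v` with
both planes anisotropic there are `T ∈ GL₂(L ⊗ L⁺_v)` and `e : U(H)(L⁺_v) ≃ₜ* U(H′)(L⁺_v)` with `e g = T⁻¹ g T`, `γ ↔ e γ` and `e⁻¹ γ′ ↔ γ′`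
(★ `Rogawski1990.Corresponds`; ★ `corresponds_cmDatumLocalCongr[_symm]`) — a local letter typed on ONE anisotropic plane at `v` moves to
every other along `↔`. [cite: Rogawski1990, §14.2 (14.2.1) p. 232] [cite: Jacobowitz1962, §3 Thm. 3.1] -/
theorem exists_cmDatum_localEquiv_corresponds_two_of_anisotropic (H H' : Matrix (Fin 2) (Fin 2) L)
    (hH : (H.map (cmConjRingHom L))ᵀ = H) (hHd : H.det ≠ 0) (hH' : (H'.map (cmConjRingHom L))ᵀ = H') (hH'd : H'.det ≠ 0)
    {v : HeightOneSpectrum (𝓞 ↥(maximalRealSubfield L))} (w : PlacesOver L v) (hw : IsCMField.complexConj L • w.1 = w.1)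
    (hanis : ∀ r : Fin 2 → LocalRing L v,
      hermForm (conjLocal L (IsCMField.complexConj L) v) ((adelicForm L 2 H).map (adeleToLocal L v)) r r = 0 → r = 0)
    (hanis' : ∀ r : Fin 2 → LocalRing L v,
      hermForm (conjLocal L (IsCMField.complexConj L) v) ((adelicForm L 2 H').map (adeleToLocal L v)) r r = 0 → r = 0) :
    ∃ (T : GL (Fin 2) (LocalRing L v)) (e : (cmDatum L 2 H).Local v ≃ₜ* (cmDatum L 2 H').Local v),
      (∀ g : (cmDatum L 2 H).Local v, ((e g).val : GL (Fin 2) (LocalRing L v)) = T⁻¹ * g.val * T) ∧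
      (∀ γ : (cmDatum L 2 H).Local v,
        Corresponds (conjLocal L (IsCMField.complexConj L) v) ((adelicForm L 2 H).map (adeleToLocal L v))
          ((adelicForm L 2 H').map (adeleToLocal L v)) γ (e γ)) ∧
      ∀ γ' : (cmDatum L 2 H').Local v,
        Corresponds (conjLocal L (IsCMField.complexConj L) v) ((adelicForm L 2 H).map (adeleToLocal L v))
          ((adelicForm L 2 H').map (adeleToLocal L v)) (e.symm γ') γ' := by
  obtain ⟨δ, hcδ, hδ⟩ := exists_complexConj_eq_neg_ne_zero L
  obtain ⟨T, hT⟩ := exists_formCongr_map_eq_map_of_anisotropic hcδ hδ H H'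
    ((map_cmConjRingHom_eq_map_complexConj L H) ▸ hH) hHd ((map_cmConjRingHom_eq_map_complexConj L H') ▸ hH') hH'd w hw hanis hanis'
  have h : formCongr (conjLocal L (IsCMField.complexConj L) v) T (H.map (algebraMap L (LocalRing L v))) =
      (1 : LocalRing L v) • H'.map (algebraMap L (LocalRing L v)) := by rw [hT, one_smul]
  refine ⟨T, (cmDatumLocalCongr L v T isUnit_one h).symm, fun g => rfl,
    fun γ => corresponds_comm.1 (corresponds_cmDatumLocalCongr_symm L v T isUnit_one h γ), fun γ' => ?_⟩
  rw [ContinuousMulEquiv.symm_symm]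
  exact corresponds_comm.1 (corresponds_cmDatumLocalCongr L v T isUnit_one h γ')

/-- **`U(H)(L⁺_v) ≃ₜ* U(H′)(L⁺_v)` for `v ∈ T(H) ∩ T(H′)`** in the standing-data currency of [Liu2021, App. D §D.1]: both planes NOT
isotropic at `v` (`¬ LemD1.IsIsotropic (standingData L v c̄ 2 · …)`, the currency of ★ `even_ncard_not_isIsotropic_iff` and of ★
`isEmpty_cmDatum_local_equiv_antidiagTwo_of_not_isIsotropic`). [cite: Jacobowitz1962, §3 Thm. 3.1] [cite: Liu2021, App. D Lem. D.1 (4)] -/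
theorem nonempty_cmDatum_local_equiv_of_not_isIsotropic (H H' : Matrix (Fin 2) (Fin 2) L)
    (hH : (H.map (cmConjRingHom L))ᵀ = H) (hHd : H.det ≠ 0) (hH' : (H'.map (cmConjRingHom L))ᵀ = H') (hH'd : H'.det ≠ 0)
    {δ : L} (hcδ : IsCMField.complexConj L δ = -δ) (hδ : δ ≠ 0) (v : HeightOneSpectrum (𝓞 ↥(maximalRealSubfield L)))
    (hv : ¬ Liu2021.LemD1.IsIsotropic (Liu2021.LemD1OfPlace.standingData L v (IsCMField.complexConj L) 2 H hcδ hδ le_rfl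
      ((map_cmConjRingHom_eq_map_complexConj L H) ▸ hH) hHd))
    (hv' : ¬ Liu2021.LemD1.IsIsotropic (Liu2021.LemD1OfPlace.standingData L v (IsCMField.complexConj L) 2 H' hcδ hδ le_rfl
      ((map_cmConjRingHom_eq_map_complexConj L H') ▸ hH') hH'd)) :
    Nonempty ((cmDatum L 2 H).Local v ≃ₜ* (cmDatum L 2 H').Local v) := by
  refine nonempty_cmDatum_local_equiv_of_anisotropic L H H' hH hHd hH' hH'd v (fun w _ r hr => ?_) (fun w _ r hr => ?_)
  · by_contra hr0
    exact hv ((isIsotropic_standingData_iff_localGram L (IsCMField.complexConj L) H v hcδ hδ le_rfl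
      ((map_cmConjRingHom_eq_map_complexConj L H) ▸ hH) hHd).2 ⟨r, hr0, hr⟩)
  · by_contra hr0
    exact hv' ((isIsotropic_standingData_iff_localGram L (IsCMField.complexConj L) H' v hcδ hδ le_rfl
      ((map_cmConjRingHom_eq_map_complexConj L H') ▸ hH') hH'd).2 ⟨r, hr0, hr⟩)

/-- **THE RANK-2 DICHOTOMY.**  For hermitian planes `H, H′ ∈ M₂(L)` with `det ≠ 0` and ANY finite place `v` of `L⁺`:
`U(H)(L⁺_v) ≃ₜ* U(H′)(L⁺_v)` exists iff `H, H′` are CO-ISOTROPIC at `v`.  `→`: an isotropic plane has group `≃ U(Φ₂)(L⁺_v)`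
(★ `nonempty_cmDatum_local_equiv_antidiag_two_of_isotropic`), impossible for an anisotropic one (compact vs non-compact,
★ `isEmpty_cmDatum_local_equiv_antidiagTwo_of_not_isIsotropic`); `←`: through `U(Φ₂)`, or `nonempty_cmDatum_local_equiv_of_not_isIsotropic`.
([Rogawski1990, §3.8 p. 33]: unitary groups in two variables at `v` ↔ `F_v^*/NE_v^*`.) [cite: Rogawski1990, §3.8 p. 33]
[cite: Jacobowitz1962, §3 Thm. 3.1] [cite: PlatonovRapinchuk1994, §3.1 Thm. 3.1] -/
theorem nonempty_cmDatum_local_equiv_two_iff (H H' : Matrix (Fin 2) (Fin 2) L)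
    (hH : (H.map (cmConjRingHom L))ᵀ = H) (hHd : H.det ≠ 0) (hH' : (H'.map (cmConjRingHom L))ᵀ = H') (hH'd : H'.det ≠ 0)
    {δ : L} (hcδ : IsCMField.complexConj L δ = -δ) (hδ : δ ≠ 0) (v : HeightOneSpectrum (𝓞 ↥(maximalRealSubfield L))) :
    Nonempty ((cmDatum L 2 H).Local v ≃ₜ* (cmDatum L 2 H').Local v) ↔
      (Liu2021.LemD1.IsIsotropic (Liu2021.LemD1OfPlace.standingData L v (IsCMField.complexConj L) 2 H hcδ hδ le_rfl
          ((map_cmConjRingHom_eq_map_complexConj L H) ▸ hH) hHd) ↔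
        Liu2021.LemD1.IsIsotropic (Liu2021.LemD1OfPlace.standingData L v (IsCMField.complexConj L) 2 H' hcδ hδ le_rfl
          ((map_cmConjRingHom_eq_map_complexConj L H') ▸ hH') hH'd)) := by
  have iso : ∀ (H₀ : Matrix (Fin 2) (Fin 2) L) (hH₀ : (H₀.map (cmConjRingHom L))ᵀ = H₀) (hH₀d : H₀.det ≠ 0),
      Liu2021.LemD1.IsIsotropic (Liu2021.LemD1OfPlace.standingData L v (IsCMField.complexConj L) 2 H₀ hcδ hδ le_rfl
        ((map_cmConjRingHom_eq_map_complexConj L H₀) ▸ hH₀) hH₀d) →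
      Nonempty ((cmDatum L 2 H₀).Local v ≃ₜ*
        (cmDatum L 2 (Matrix.of fun i j : Fin 2 => if i.val + j.val + 1 = 2 then (1 : L) else 0)).Local v) :=
    fun H₀ hH₀ hH₀d hiso => nonempty_cmDatum_local_equiv_antidiag_two_of_isotropic L H₀ hH₀ hH₀d v fun w _ =>
      (isIsotropic_standingData_iff_localGram L (IsCMField.complexConj L) H₀ v hcδ hδ le_rfl
        ((map_cmConjRingHom_eq_map_complexConj L H₀) ▸ hH₀) hH₀d).1 hiso
  constructor
  · rintro ⟨e⟩
    refine ⟨fun hiso => by_contra fun hnot => ?_, fun hiso' => by_contra fun hnot => ?_⟩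
    · obtain ⟨e₀⟩ := iso H hH hHd hiso
      exact (isEmpty_cmDatum_local_equiv_antidiagTwo_of_not_isIsotropic L H' hH' hH'd hcδ hδ v hnot).false (e.symm.trans e₀)
    · obtain ⟨e₀⟩ := iso H' hH' hH'd hiso'
      exact (isEmpty_cmDatum_local_equiv_antidiagTwo_of_not_isIsotropic L H hH hHd hcδ hδ v hnot).false (e.trans e₀)
  · intro hiff
    by_cases hiso : Liu2021.LemD1.IsIsotropic (Liu2021.LemD1OfPlace.standingData L v (IsCMField.complexConj L) 2 H hcδ hδ le_rfl
        ((map_cmConjRingHom_eq_map_complexConj L H) ▸ hH) hHd)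
    · obtain ⟨e₁⟩ := iso H hH hHd hiso
      obtain ⟨e₂⟩ := iso H' hH' hH'd (hiff.1 hiso)
      exact ⟨e₁.trans e₂.symm⟩
    · exact nonempty_cmDatum_local_equiv_of_not_isIsotropic L H H' hH hHd hH' hH'd hcδ hδ v hiso (fun h => hiso (hiff.2 h))

end CM

end Literature.NumberTheory.Automorphic.UnitaryGroup
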